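import Mathlib
import Summits.ValiantsHypothesis.ValiantsHypothesis.Theorems.KPlusLogSqLawWeakLiftingTowerGraftSignedCrossingRegular

/-!
# Tower graft line — SIGNED CROSSINGS VIII: spectral flow = sum of signatures over regular crossings

Structure file for LINE (B) `Cruxes/WeakLifting/Lines/tower_graft.lean` (crux `WeakLifting` = stmt-ValiantsHypothesis-19561),
eighth of the SIGNED-CROSSING series: the global assembly of file VII's local signature law.

§1 THE ABSTRACT FLOW LAW from local jump data: a real symmetric family `H` with entries differentiable on `[a, b]` and two bookkeeping
   functions `kL kR : ℝ → ℕ` such that at every `t ∈ [a, b]`, `ν₋(u) = ν₋(t) + kL t` just left of `t` and `ν₋(u) = ν₋(t) + kR t` just right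
   of `t`.  Then (`kL_eq_zero_of_det_ne_zero` / `kR_eq_zero_of_det_ne_zero`) the data vanish off the roots, (`negCount_step_data`) across a
   root-free `(c, d)`: `ν₋(c) + kR c = ν₋(d) + kL d`, and ★ `sum_kL_add_negCount_eq_sum_kR_add_negCount`: for `a, b` non-roots and every finite
   `T ⊆ (a, b)` containing the roots, `Σ_{t ∈ T} kL t + ν₋(b) = Σ_{t ∈ T} kR t + ν₋(a)`.  (Files III/V are the cases `(kL, kR) = (ν₀, 0)`,
   `(0, ν₀)` root by root.)
§2 ★★ `sum_card_pos_add_negCount_eq_sum_card_neg_add_negCount` — **SPECTRAL FLOW = Σ SIGNATURES (Robbin–Salamon, finite-dimensional real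
   symmetric case)**: `a, b` non-roots; a finite `T ⊆ (a, b)` containing the roots; at each `t ∈ T` frames `Qp t`, `Qm t` in `ker H(t)` on which
   `H′ t` is positive, resp. negative, with `|κp t| + |κm t| = ν₀(t)` (every root a REGULAR crossing, split by the user).  Then
   `Σ_{t ∈ T} |κp t| + ν₋(b) = Σ_{t ∈ T} |κm t| + ν₋(a)`, i.e. `ν₋(a) − ν₋(b) = Σ_t sign(kernel crossing form at t)`.
READING FOR THE LINE (honest): for a one-letter graft every root whose kernel sees the co-Euler base NONDEGENERATELY contributes the signature of
minus the base on the kernel; only isotropic kernels (folds, memo T3) escape the count.  Zero stub credit; S4/S5, TowerB, WeakLifting,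
Conjecture B, 18050, VP ≠ VNP untouched.  Def-free; Mathlib + files I–VII.  Seat: prover val-sym-lift-p2 g24,
`--supports stmt-ValiantsHypothesis-19561 --as helper`.  [folklore: Robbin–Salamon 1995 §4 (finite-dimensional case); packaging this work]
-/

-- `Summit.ValiantsHypothesis.ValiantsHypothesis.…` repeats a component by the D-0017 layout
-- (single-conjunct summit), which the `dupNamespace` linter flags; the name is mandated.
set_option linter.dupNamespace false
set_option autoImplicit false

namespace Summit.ValiantsHypothesis.ValiantsHypothesis.Theorems.KPlusLogSqLaw.TowerGraft

open Matrix Finset Filter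
open scoped BigOperators Topology

namespace SignedCrossing

variable {ι : Type} [Fintype ι] [DecidableEq ι]

/-! ## §1 The abstract flow law from local jump data -/

section Data

/-- right jump data vanish off the roots: if `det H t ≠ 0` and `ν₋(u) = ν₋(t) + k` just right of `t`, then `k = 0`
(`ν₋` is locally constant there and `𝓝[>] t` is nontrivial). [folklore] -/
theorem kR_eq_zero_of_det_ne_zero (H H' : ℝ → Matrix ι ι ℝ) (hH : ∀ u, (H u).IsHermitian) (t : ℝ)
    (hd : ∀ i j, HasDerivAt (fun u => H u i j) (H' t i j) t) (hdet : (H t).det ≠ 0) {k : ℕ}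
    (hR : ∀ᶠ u in 𝓝[>] t, (univ.filter fun i => (hH u).eigenvalues i < 0).card = (univ.filter fun i => (hH t).eigenvalues i < 0).card + k) :
    k = 0 := by
  have hcont : ∀ i j, ContinuousAt (fun u => H u i j) t := fun i j => (hd i j).continuousAt
  have hc := (eventually_negCount_eq_of_det_ne_zero H hH t hcont hdet).filter_mono (nhdsWithin_le_nhds (s := Set.Ioi t))
  obtain ⟨u, hu1, hu2⟩ := (hR.and hc).exists
  omega

/-- left jump data vanish off the roots. [folklore] -/
theorem kL_eq_zero_of_det_ne_zero (H H' : ℝ → Matrix ι ι ℝ) (hH : ∀ u, (H u).IsHermitian) (t : ℝ)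
    (hd : ∀ i j, HasDerivAt (fun u => H u i j) (H' t i j) t) (hdet : (H t).det ≠ 0) {k : ℕ}
    (hL : ∀ᶠ u in 𝓝[<] t, (univ.filter fun i => (hH u).eigenvalues i < 0).card = (univ.filter fun i => (hH t).eigenvalues i < 0).card + k) :
    k = 0 := by
  have hcont : ∀ i j, ContinuousAt (fun u => H u i j) t := fun i j => (hd i j).continuousAt
  have hc := (eventually_negCount_eq_of_det_ne_zero H hH t hcont hdet).filter_mono (nhdsWithin_le_nhds (s := Set.Iio t))
  obtain ⟨u, hu1, hu2⟩ := (hL.and hc).exists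
  omega

/-- **step with data**: `(c, d)` root-free, `a ≤ c < d ≤ b` ⇒ `ν₋(c) + kR c = ν₋(d) + kL d`. [this work] -/
theorem negCount_step_data (H H' : ℝ → Matrix ι ι ℝ) (hH : ∀ u, (H u).IsHermitian) {a b : ℝ}
    (hd : ∀ u, a ≤ u → u ≤ b → ∀ i j, HasDerivAt (fun x => H x i j) (H' u i j) u) (kL kR : ℝ → ℕ)
    (hL : ∀ t, a ≤ t → t ≤ b → ∀ᶠ u in 𝓝[<] t,
      (univ.filter fun i => (hH u).eigenvalues i < 0).card = (univ.filter fun i => (hH t).eigenvalues i < 0).card + kL t)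
    (hR : ∀ t, a ≤ t → t ≤ b → ∀ᶠ u in 𝓝[>] t,
      (univ.filter fun i => (hH u).eigenvalues i < 0).card = (univ.filter fun i => (hH t).eigenvalues i < 0).card + kR t)
    {c d : ℝ} (hac : a ≤ c) (hcd : c < d) (hdb : d ≤ b) (hfree : ∀ u, c < u → u < d → (H u).det ≠ 0) :
    (univ.filter fun i => (hH c).eigenvalues i < 0).card + kR c = (univ.filter fun i => (hH d).eigenvalues i < 0).card + kL d := by
  have hcb : c ≤ b := hcd.le.trans hdb
  have had : a ≤ d := hac.trans hcd.le
  obtain ⟨R, hRc, hRsub⟩ := mem_nhdsGT_iff_exists_Ioo_subset.mp (hR c hac hcb)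
  obtain ⟨L, hLd, hLsub⟩ := mem_nhdsLT_iff_exists_Ioo_subset.mp (hL d had hdb)
  rw [Set.mem_Ioi] at hRc; rw [Set.mem_Iio] at hLd
  set u₁ : ℝ := (c + min R d) / 2 with hu₁
  have hm : c < min R d := lt_min hRc hcd
  have hm1 : min R d ≤ R := min_le_left _ _; have hm2 : min R d ≤ d := min_le_right _ _
  have hu₁c : c < u₁ := by rw [hu₁]; linarith
  have hu₁R : u₁ < R := by rw [hu₁]; linarith
  have hu₁d : u₁ < d := by rw [hu₁]; linarith
  set u₂ : ℝ := (max L u₁ + d) / 2 with hu₂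
  have hM : max L u₁ < d := max_lt hLd hu₁d
  have hM1 : L ≤ max L u₁ := le_max_left _ _; have hM2 : u₁ ≤ max L u₁ := le_max_right _ _
  have hu₂d : u₂ < d := by rw [hu₂]; linarith
  have hLu₂ : L < u₂ := by rw [hu₂]; linarith
  have hu₁u₂ : u₁ < u₂ := by rw [hu₂]; linarith
  have h1 := hRsub ⟨hu₁c, hu₁R⟩
  have h2 := hLsub ⟨hLu₂, hu₂d⟩
  simp only [Set.mem_setOf_eq] at h1 h2
  have h12 := negCount_eq_of_forall_det_ne_zero H H' hH hd (hac.trans hu₁c.le) hu₁u₂.le (hu₂d.le.trans hdb)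
    fun u hu1 hu2 => hfree u (hu₁c.trans_le hu1) (lt_of_le_of_lt hu2 hu₂d)
  omega

/-- **THE ABSTRACT FLOW LAW**: entries differentiable on `[a, b]`, jump data `kL, kR` at every point of `[a, b]`, `a, b` non-roots ⇒ for every
finite `T ⊆ (a, b)` containing the roots, `Σ_{t ∈ T} kL t + ν₋(b) = Σ_{t ∈ T} kR t + ν₋(a)`. [this work] -/
theorem sum_kL_add_negCount_eq_sum_kR_add_negCount (H H' : ℝ → Matrix ι ι ℝ) (hH : ∀ u, (H u).IsHermitian) {a b : ℝ}
    (hd : ∀ u, a ≤ u → u ≤ b → ∀ i j, HasDerivAt (fun x => H x i j) (H' u i j) u) (kL kR : ℝ → ℕ)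
    (hL : ∀ t, a ≤ t → t ≤ b → ∀ᶠ u in 𝓝[<] t,
      (univ.filter fun i => (hH u).eigenvalues i < 0).card = (univ.filter fun i => (hH t).eigenvalues i < 0).card + kL t)
    (hR : ∀ t, a ≤ t → t ≤ b → ∀ᶠ u in 𝓝[>] t,
      (univ.filter fun i => (hH u).eigenvalues i < 0).card = (univ.filter fun i => (hH t).eigenvalues i < 0).card + kR t)
    (hab : a ≤ b) (ha0 : (H a).det ≠ 0) (hb0 : (H b).det ≠ 0)
    (T : Finset ℝ) (hT : ∀ t ∈ T, a < t ∧ t < b) (hcov : ∀ u, a < u → u < b → (H u).det = 0 → u ∈ T) :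
    (∑ t ∈ T, kL t) + (univ.filter fun i => (hH b).eigenvalues i < 0).card =
      (∑ t ∈ T, kR t) + (univ.filter fun i => (hH a).eigenvalues i < 0).card := by
  classical
  -- data vanish at non-roots of `[a, b]`
  have hzero : ∀ u, a ≤ u → u ≤ b → (H u).det ≠ 0 → kL u = 0 ∧ kR u = 0 := fun u hu1 hu2 h0 =>
    ⟨kL_eq_zero_of_det_ne_zero H H' hH u (hd u hu1 hu2) h0 (hL u hu1 hu2),
      kR_eq_zero_of_det_ne_zero H H' hH u (hd u hu1 hu2) h0 (hR u hu1 hu2)⟩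
  suffices key : ∀ b', a ≤ b' → b' ≤ b → (H b').det ≠ 0 → (∀ t ∈ T, a < t ∧ t < b') →
      (∀ u, a < u → u < b' → (H u).det = 0 → u ∈ T) →
      (∑ t ∈ T, kL t) + (univ.filter fun i => (hH b').eigenvalues i < 0).card =
        (∑ t ∈ T, kR t) + (univ.filter fun i => (hH a).eigenvalues i < 0).card from key b hab le_rfl hb0 hT hcov
  clear hT hcov
  induction T using Finset.induction_on_max with
  | empty =>
    intro b' hab' hb'b hb'0 _ hcov'
    simp only [Finset.sum_empty, zero_add]
    refine (negCount_eq_of_forall_det_ne_zero H H' hH hd le_rfl hab' hb'b fun u hu1 hu2 h0 => ?_).symm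
    rcases hu1.eq_or_lt with rfl | hlt1
    · exact ha0 h0
    rcases hu2.eq_or_lt with rfl | hlt2
    · exact hb'0 h0
    exact (Finset.notMem_empty u) (hcov' u hlt1 hlt2 h0)
  | insert t₀ S hlt ih =>
    intro b' hab' hb'b hb'0 hT' hcov'
    have ht₀ := hT' t₀ (Finset.mem_insert_self _ _)
    have ht₀S : t₀ ∉ S := fun h => lt_irrefl _ (hlt t₀ h)
    obtain ⟨lo, halo, hlot₀, hSlo, hlofree⟩ : ∃ lo, a ≤ lo ∧ lo < t₀ ∧ (∀ t ∈ S, t ≤ lo) ∧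
        (∀ u, lo < u → u < t₀ → (H u).det ≠ 0) := by
      rcases S.eq_empty_or_nonempty with hSe | hSne
      · refine ⟨a, le_rfl, ht₀.1, fun t ht => ?_, fun u hu1 hu2 h0 => ?_⟩
        · rw [hSe] at ht
          exact absurd ht (Finset.notMem_empty t)
        · have hu := hcov' u hu1 (hu2.trans ht₀.2) h0
          rw [hSe] at hu
          rcases Finset.mem_insert.mp hu with rfl | hu'
          · exact lt_irrefl _ hu2
          · exact Finset.notMem_empty u hu'
      · refine ⟨S.max' hSne, (hT' _ (Finset.mem_insert_of_mem (Finset.max'_mem S hSne))).1.le,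
          hlt _ (Finset.max'_mem S hSne), fun t ht => Finset.le_max' S t ht, fun u hu1 hu2 h0 => ?_⟩
        have hu := hcov' u ((hT' _ (Finset.mem_insert_of_mem (Finset.max'_mem S hSne))).1.trans hu1) (hu2.trans ht₀.2) h0
        rcases Finset.mem_insert.mp hu with rfl | hu'
        · exact lt_irrefl _ hu2
        · exact not_le.mpr hu1 (Finset.le_max' S u hu')
    set b'' : ℝ := (lo + t₀) / 2 with hb''
    have hlob'' : lo < b'' := by rw [hb'']; linarith
    have hb''t₀ : b'' < t₀ := by rw [hb'']; linarith
    have hb''0 : (H b'').det ≠ 0 := hlofree b'' hlob'' hb''t₀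
    have hIH := ih b'' (halo.trans hlob''.le) (hb''t₀.le.trans (ht₀.2.le.trans hb'b)) hb''0
      (fun t ht => ⟨(hT' t (Finset.mem_insert_of_mem ht)).1, lt_of_le_of_lt (hSlo t ht) hlob''⟩)
      (fun u hu1 hu2 h0 => by
        have hu := hcov' u hu1 (hu2.trans (hb''t₀.trans ht₀.2)) h0
        rcases Finset.mem_insert.mp hu with rfl | hu'
        · exact absurd (hu2.trans hb''t₀) (lt_irrefl _)
        · exact hu')
    -- the two steps around `t₀`, between the non-roots `b''` and `b'`
    have hs1 := negCount_step_data H H' hH hd kL kR hL hR (halo.trans hlob''.le) hb''t₀ (ht₀.2.le.trans hb'b)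
      fun u hu1 hu2 h0 => by
        have hu := hcov' u (lt_trans (halo.trans_lt hlob'') hu1) (hu2.trans ht₀.2) h0
        rcases Finset.mem_insert.mp hu with rfl | hu'
        · exact lt_irrefl _ hu2
        · exact not_le.mpr (hlob''.trans hu1) (hSlo u hu')
    have hs2 := negCount_step_data H H' hH hd kL kR hL hR (halo.trans (hlob''.le.trans hb''t₀.le)) ht₀.2 hb'b
      fun u hu1 hu2 h0 => by
        have hu := hcov' u (ht₀.1.trans hu1) hu2 h0
        rcases Finset.mem_insert.mp hu with rfl | hu'
        · exact lt_irrefl _ hu1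
        · exact lt_asymm hu1 (hlt u hu')
    have hzb'' := hzero b'' (halo.trans hlob''.le) (hb''t₀.le.trans (ht₀.2.le.trans hb'b)) hb''0
    have hzb' := hzero b' hab' hb'b hb'0
    rw [Finset.sum_insert ht₀S, Finset.sum_insert ht₀S]
    omega

end Data

/-! ## §2 Spectral flow = Σ signatures over regular crossings -/

section Signature

/-- **SPECTRAL FLOW = SUM OF SIGNATURES (regular crossings).**  `H` real symmetric, entries differentiable on `[a, b]`, `det H a ≠ 0`,
`det H b ≠ 0`; `T ⊆ (a, b)` finite containing the roots of `det H` in `(a, b)`; for each `t ∈ T`, frames `Qp t : Matrix ι (κp t) ℝ` and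
`Qm t : Matrix ι (κm t) ℝ` with columns in `ker H(t)`, `H′ t` positive on `col (Qp t) ∖ 0` and negative on `col (Qm t) ∖ 0`, and
`|κp t| + |κm t| = ν₀(t)`.  Then `Σ_{t ∈ T} |κp t| + ν₋(b) = Σ_{t ∈ T} |κm t| + ν₋(a)`.
[folklore: Robbin–Salamon, finite-dimensional symmetric case; packaging this work] -/
theorem sum_card_pos_add_negCount_eq_sum_card_neg_add_negCount (H H' : ℝ → Matrix ι ι ℝ) (hH : ∀ u, (H u).IsHermitian) {a b : ℝ}
    (hd : ∀ u, a ≤ u → u ≤ b → ∀ i j, HasDerivAt (fun x => H x i j) (H' u i j) u)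
    (hab : a ≤ b) (ha0 : (H a).det ≠ 0) (hb0 : (H b).det ≠ 0)
    (T : Finset ℝ) (hT : ∀ t ∈ T, a < t ∧ t < b) (hcov : ∀ u, a < u → u < b → (H u).det = 0 → u ∈ T)
    (κp κm : ℝ → Type) [∀ t, Fintype (κp t)] [∀ t, Fintype (κm t)]
    (Qp : ∀ t, Matrix ι (κp t) ℝ) (Qm : ∀ t, Matrix ι (κm t) ℝ)
    (hQpker : ∀ t ∈ T, ∀ c : κp t → ℝ, H t *ᵥ (Qp t *ᵥ c) = 0)
    (hQp : ∀ t ∈ T, ∀ c : κp t → ℝ, c ≠ 0 → 0 < (Qp t *ᵥ c) ⬝ᵥ H' t *ᵥ (Qp t *ᵥ c))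
    (hQmker : ∀ t ∈ T, ∀ c : κm t → ℝ, H t *ᵥ (Qm t *ᵥ c) = 0)
    (hQm : ∀ t ∈ T, ∀ c : κm t → ℝ, c ≠ 0 → (Qm t *ᵥ c) ⬝ᵥ H' t *ᵥ (Qm t *ᵥ c) < 0)
    (hreg : ∀ t ∈ T, Fintype.card (κp t) + Fintype.card (κm t) = (univ.filter fun i => (hH t).eigenvalues i = 0).card) :
    (∑ t ∈ T, Fintype.card (κp t)) + (univ.filter fun i => (hH b).eigenvalues i < 0).card =
      (∑ t ∈ T, Fintype.card (κm t)) + (univ.filter fun i => (hH a).eigenvalues i < 0).card := by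
  classical
  -- jump data: the frame sizes on `T`, zero elsewhere
  let kL : ℝ → ℕ := fun t => if t ∈ T then Fintype.card (κp t) else 0
  let kR : ℝ → ℕ := fun t => if t ∈ T then Fintype.card (κm t) else 0
  -- off `T`, points of `[a, b]` are non-roots
  have hnonroot : ∀ t, a ≤ t → t ≤ b → t ∉ T → (H t).det ≠ 0 := by
    intro t hat htb htT h0
    rcases hat.eq_or_lt with rfl | hlt1
    · exact ha0 h0
    rcases htb.eq_or_lt with rfl | hlt2
    · exact hb0 h0
    exact htT (hcov t hlt1 hlt2 h0)
  have hL : ∀ t, a ≤ t → t ≤ b → ∀ᶠ u in 𝓝[<] t,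
      (univ.filter fun i => (hH u).eigenvalues i < 0).card = (univ.filter fun i => (hH t).eigenvalues i < 0).card + kL t := by
    intro t hat htb
    by_cases htT : t ∈ T
    · have h := eventually_negCount_eq_left_of_regular H hH t H' (hd t hat htb) (Qp t) (hQpker t htT) (hQp t htT)
        (Qm t) (hQmker t htT) (hQm t htT) (hreg t htT)
      simpa only [kL, htT, if_true] using h
    · have hcont : ∀ i j, ContinuousAt (fun u => H u i j) t := fun i j => (hd t hat htb i j).continuousAt
      have h := (eventually_negCount_eq_of_det_ne_zero H hH t hcont (hnonroot t hat htb htT)).filter_mono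
        (nhdsWithin_le_nhds (s := Set.Iio t))
      simpa only [kL, htT, if_false, add_zero] using h
  have hR : ∀ t, a ≤ t → t ≤ b → ∀ᶠ u in 𝓝[>] t,
      (univ.filter fun i => (hH u).eigenvalues i < 0).card = (univ.filter fun i => (hH t).eigenvalues i < 0).card + kR t := by
    intro t hat htb
    by_cases htT : t ∈ T
    · have h := eventually_negCount_eq_right_of_regular H hH t H' (hd t hat htb) (Qp t) (hQpker t htT) (hQp t htT)
        (Qm t) (hQmker t htT) (hQm t htT) (hreg t htT)
      simpa only [kR, htT, if_true] using h
    · have hcont : ∀ i j, ContinuousAt (fun u => H u i j) t := fun i j => (hd t hat htb i j).continuousAt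
      have h := (eventually_negCount_eq_of_det_ne_zero H hH t hcont (hnonroot t hat htb htT)).filter_mono
        (nhdsWithin_le_nhds (s := Set.Ioi t))
      simpa only [kR, htT, if_false, add_zero] using h
  have hmain := sum_kL_add_negCount_eq_sum_kR_add_negCount H H' hH hd kL kR hL hR hab ha0 hb0 T hT hcov
  have hsumL : (∑ t ∈ T, kL t) = ∑ t ∈ T, Fintype.card (κp t) :=
    Finset.sum_congr rfl fun t ht => by simp only [kL, ht, if_true]
  have hsumR : (∑ t ∈ T, kR t) = ∑ t ∈ T, Fintype.card (κm t) :=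
    Finset.sum_congr rfl fun t ht => by simp only [kR, ht, if_true]
  rw [hsumL, hsumR] at hmain
  exact hmain

/-- corollary: with regular crossings the net flux `ν₋(a) − ν₋(b)` (an integer of absolute value `≤ |ι|`) equals the sum of the signatures
`|κp t| − |κm t|`; in particular the positive kernel directions outnumber the negative ones by at most `|ι|` in total, and conversely.
[this work] -/
theorem sum_card_pos_le_sum_card_neg_add (H H' : ℝ → Matrix ι ι ℝ) (hH : ∀ u, (H u).IsHermitian) {a b : ℝ}
    (hd : ∀ u, a ≤ u → u ≤ b → ∀ i j, HasDerivAt (fun x => H x i j) (H' u i j) u)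
    (hab : a ≤ b) (ha0 : (H a).det ≠ 0) (hb0 : (H b).det ≠ 0)
    (T : Finset ℝ) (hT : ∀ t ∈ T, a < t ∧ t < b) (hcov : ∀ u, a < u → u < b → (H u).det = 0 → u ∈ T)
    (κp κm : ℝ → Type) [∀ t, Fintype (κp t)] [∀ t, Fintype (κm t)]
    (Qp : ∀ t, Matrix ι (κp t) ℝ) (Qm : ∀ t, Matrix ι (κm t) ℝ)
    (hQpker : ∀ t ∈ T, ∀ c : κp t → ℝ, H t *ᵥ (Qp t *ᵥ c) = 0)
    (hQp : ∀ t ∈ T, ∀ c : κp t → ℝ, c ≠ 0 → 0 < (Qp t *ᵥ c) ⬝ᵥ H' t *ᵥ (Qp t *ᵥ c))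
    (hQmker : ∀ t ∈ T, ∀ c : κm t → ℝ, H t *ᵥ (Qm t *ᵥ c) = 0)
    (hQm : ∀ t ∈ T, ∀ c : κm t → ℝ, c ≠ 0 → (Qm t *ᵥ c) ⬝ᵥ H' t *ᵥ (Qm t *ᵥ c) < 0)
    (hreg : ∀ t ∈ T, Fintype.card (κp t) + Fintype.card (κm t) = (univ.filter fun i => (hH t).eigenvalues i = 0).card) :
    (∑ t ∈ T, Fintype.card (κp t)) ≤ (∑ t ∈ T, Fintype.card (κm t)) + Fintype.card ι ∧
      (∑ t ∈ T, Fintype.card (κm t)) ≤ (∑ t ∈ T, Fintype.card (κp t)) + Fintype.card ι := by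
  have h := sum_card_pos_add_negCount_eq_sum_card_neg_add_negCount H H' hH hd hab ha0 hb0 T hT hcov κp κm Qp Qm hQpker hQp
    hQmker hQm hreg
  have ha : (univ.filter fun i => (hH a).eigenvalues i < 0).card ≤ Fintype.card ι := (Finset.card_filter_le _ _).trans (by simp)
  have hb : (univ.filter fun i => (hH b).eigenvalues i < 0).card ≤ Fintype.card ι := (Finset.card_filter_le _ _).trans (by simp)
  constructor <;> omega

end Signature

end SignedCrossing

end Summit.ValiantsHypothesis.ValiantsHypothesis.Theorems.KPlusLogSqLaw.TowerGraft
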